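/-
Copyright (c) 2026. All rights reserved.
Released under Apache 2.0 license as described in the file LICENSE.
-/
import Summits.AtomisticToContinuum.Crystallization.Theorems.OverbindingBudgetAffineFarStraighteningConformal
import Summits.AtomisticToContinuum.Crystallization.Theorems.OverbindingBudgetAffineFarStraighteningExt
import Summits.AtomisticToContinuum.Crystallization.Theorems.OverbindingBudgetAffineFarDevelopmentPattern

/-!
# Overbinding budget, affine far field — DEVELOPMENT, the PAIR SNAP (lens-4 g59, brick D-B)

Slot Z of `stmt-AtomisticToContinuum-31280`, leaf `…FarSmoothSplit.AffineChartStraightening'` (R_aff′), radial development (memo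
`NODE-g59-DevSpec.md` §3, lemma L3).  Two adjacent framed sites `j, m` in FIT SPACE: site `j` reads its neighbours in the frame `a • Aj`
(`a = nn_j`, pattern `P`, accuracy `ε·a`), site `m` in the frame `b • Am` (`b = nn_m`, pattern `P'`, accuracy `ε·b`); `e ∈ P` is the label of
`m` at `j`, `f ∈ P'` the label of `j` at `m`.  The physical identities "both sites see each other" and "site `j` labels every common
neighbour of `f`" become the FIT RELATIONS
* (R0) `‖a • Aj e + b • Am f‖ ≤ ε (a + b)`,
* (R1) every `c'` of the common shell of `f` in `P'` has a label `w ∈ P` with `‖b • Am c' − a • Aj (w − e)‖ ≤ ε (2a + b)`.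

**`pair_snap`**: under (R0), (R1), frames `τ`-close to isometries with `τ ≤ 1/20`, `ε ≤ 1/1000` and comparable scales
(`b ≤ 21a/20`, `a ≤ 10b/9`) there is a linear ISOMETRY `U` with
1. `IsSnap P P' e f U` (exact relabelling of all shared first-shell sites: `U f = −e`, common shell to common shell),
2. the TRANSFER estimate `‖a • Aj (U v) − b • Am v‖ ≤ 4 ε (2a + b) ‖v‖` (the two affine frames differ by `U` up to `O(ε)`), and
3. ROUNDING: any two readings `u ∈ P ∪ {0}` at `j`, `u' ∈ P' ∪ {0}` at `m` of one physical point (`‖a • Aj u − a • Aj e − b • Am u'‖ ≤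
   ε (2a + b)`) satisfy `u = e + U u'` EXACTLY.

Assembly of the bricks: `exists_goodPair` (S0) → labels of the good pair lie in the common shell of `e` by the PATTERN GAP
(`norm_sub_eq_one_or_sqrt_two_le_of_twoShell`, D-A) and the frame bounds (S1) → FRAME (`frameRealisation_holds`) realises the three readings
exactly by `M` and fits `b • Am` by `M'` (S2, S3) → HALF-FRAME (`linearMap_eq_of_halfFrame`, D-A): `a • Aj ∘ M = M'` (S4) → CONF
(`nearConformal_transfer`, budget `20 ε (2a+b) + 10 b τ ≤ b (1 − τ)`) (S5) → SNAP (`snapRigidity_pair`): `M` is an isometry `U` (S6) → EXT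
(`snapExtension_holds`, threshold `1/3`) upgrades `U` to a full `IsSnap` (S7) → COMPAT (`snapCompatibility_holds`, threshold `1`) rounds (S9).
-/

namespace Summit.AtomisticToContinuum.Crystallization.Theorems.OverbindingBudgetAffineFarSmoothSplit

open Literature.Geometry.DiscreteGeometry (fccTwoShellPattern hcpTwoShellPattern norm_le_sqrt_two_of_mem_twoShellPattern nearestDist
  nearestDist_le_dist)
open scoped RealInnerProductSpace

/-! ## §1  Frame bounds -/

/-- Lower frame bound: `a (19/20) ‖x‖ ≤ ‖a • A x‖` for `A` `τ`-close to an isometry, `τ ≤ 1/20`. [folklore] -/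
theorem frame_lower {A : EuclideanSpace ℝ (Fin 3) →ₗ[ℝ] EuclideanSpace ℝ (Fin 3)} {Q : EuclideanSpace ℝ (Fin 3) →ₗᵢ[ℝ] EuclideanSpace ℝ (Fin 3)}
    {a τ : ℝ} (ha : 0 < a) (hτ : τ ≤ 1 / 20) (hA : ∀ v, ‖A v - Q v‖ ≤ τ * ‖v‖) (x : EuclideanSpace ℝ (Fin 3)) :
    a * (19 / 20 * ‖x‖) ≤ ‖a • A x‖ := by
  rw [norm_smul, Real.norm_eq_abs, abs_of_pos ha]
  refine mul_le_mul_of_nonneg_left ?_ ha.le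
  have h1 := norm_sub_norm_le (Q x) (A x)
  rw [norm_sub_rev, LinearIsometry.norm_map] at h1
  have h2 := hA x
  have h3 : τ * ‖x‖ ≤ 1 / 20 * ‖x‖ := mul_le_mul_of_nonneg_right hτ (norm_nonneg _)
  linarith

/-- Upper frame bound: `‖a • A x‖ ≤ a (21/20) ‖x‖`. [folklore] -/
theorem frame_upper {A : EuclideanSpace ℝ (Fin 3) →ₗ[ℝ] EuclideanSpace ℝ (Fin 3)} {Q : EuclideanSpace ℝ (Fin 3) →ₗᵢ[ℝ] EuclideanSpace ℝ (Fin 3)}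
    {a τ : ℝ} (ha : 0 < a) (hτ : τ ≤ 1 / 20) (hA : ∀ v, ‖A v - Q v‖ ≤ τ * ‖v‖) (x : EuclideanSpace ℝ (Fin 3)) :
    ‖a • A x‖ ≤ a * (21 / 20 * ‖x‖) := by
  rw [norm_smul, Real.norm_eq_abs, abs_of_pos ha]
  refine mul_le_mul_of_nonneg_left ?_ ha.le
  have h1 := norm_le_insert' (A x) (Q x)
  rw [LinearIsometry.norm_map] at h1
  have h2 := hA x
  have h3 : τ * ‖x‖ ≤ 1 / 20 * ‖x‖ := mul_le_mul_of_nonneg_right hτ (norm_nonneg _)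
  linarith

/-- `7/5 ≤ √2`. [folklore] -/
theorem seven_fifths_le_sqrt_two : (7 / 5 : ℝ) ≤ Real.sqrt 2 := by
  have h : (7 / 5 : ℝ) = Real.sqrt ((7 / 5) ^ 2) := (Real.sqrt_sq (by norm_num)).symm
  rw [h]; exact Real.sqrt_le_sqrt (by norm_num)

/-- `√2 ≤ 3/2`. [folklore] -/
theorem sqrt_two_le_three_halves : Real.sqrt 2 ≤ (3 / 2 : ℝ) := by
  have h : (3 / 2 : ℝ) = Real.sqrt ((3 / 2) ^ 2) := (Real.sqrt_sq (by norm_num)).symm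
  rw [h]; exact Real.sqrt_le_sqrt (by norm_num)

/-- FRAME COMPARISON: if `a • Aj x` is `δ`-close to `b • Am x'` with `‖x'‖ = 1`, comparable scales and small `δ`, then `‖x‖ < √2` and
`x ≠ 0` — so by the pattern gap a pattern difference `x` has norm exactly `1`. [this file] -/
theorem frame_cmp {Aj Am : EuclideanSpace ℝ (Fin 3) →ₗ[ℝ] EuclideanSpace ℝ (Fin 3)}
    {Qj Qm : EuclideanSpace ℝ (Fin 3) →ₗᵢ[ℝ] EuclideanSpace ℝ (Fin 3)} {a b τ δ : ℝ} (ha : 0 < a) (hb : 0 < b) (hab : b ≤ 21 / 20 * a)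
    (hba : a ≤ 10 / 9 * b) (hτ : τ ≤ 1 / 20) (hj : ∀ v, ‖Aj v - Qj v‖ ≤ τ * ‖v‖) (hm : ∀ v, ‖Am v - Qm v‖ ≤ τ * ‖v‖)
    {x x' : EuclideanSpace ℝ (Fin 3)} (hx' : ‖x'‖ = 1) (h : ‖a • Aj x - b • Am x'‖ ≤ δ) (hδ : δ ≤ 61 / 10000 * a) :
    ‖x‖ < Real.sqrt 2 ∧ x ≠ 0 := by
  have hlo := frame_lower ha hτ hj x
  have hup := frame_upper hb hτ hm x'
  have hlo' := frame_lower hb hτ hm x'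
  rw [hx', mul_one] at hup hlo'
  have htri : ‖a • Aj x‖ ≤ ‖b • Am x'‖ + δ := by
    have := norm_le_insert' (a • Aj x) (b • Am x'); linarith
  constructor
  · have h1 : a * (19 / 20 * ‖x‖) ≤ a * (7 / 6) := by nlinarith
    have h2 : 19 / 20 * ‖x‖ ≤ 7 / 6 := le_of_mul_le_mul_left h1 ha
    have h3 := seven_fifths_le_sqrt_two
    linarith
  · intro hx0
    rw [hx0, map_zero, smul_zero, zero_sub, norm_neg] at h
    nlinarith

/-! ## §2  The pair snap -/

/-- LABELS LAND IN THE COMMON SHELL (step S1): under (R0), an (R1)-label `w ∈ P` of a common neighbour `c'` of `f` is a common neighbour of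
`e`. [this file] -/
theorem label_inCommonShell {P P' : Finset (EuclideanSpace ℝ (Fin 3))} (hP : P = fccTwoShellPattern ∨ P = hcpTwoShellPattern)
    {e f : EuclideanSpace ℝ (Fin 3)} (he : e ∈ P) {Aj Am : EuclideanSpace ℝ (Fin 3) →ₗ[ℝ] EuclideanSpace ℝ (Fin 3)}
    {Qj Qm : EuclideanSpace ℝ (Fin 3) →ₗᵢ[ℝ] EuclideanSpace ℝ (Fin 3)} {a b τ ε : ℝ} (ha : 0 < a) (hb : 0 < b) (hab : b ≤ 21 / 20 * a)
    (hba : a ≤ 10 / 9 * b) (hτ : τ ≤ 1 / 20) (hε0 : 0 ≤ ε) (hε : ε ≤ 1 / 1000) (hj : ∀ v, ‖Aj v - Qj v‖ ≤ τ * ‖v‖)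
    (hm : ∀ v, ‖Am v - Qm v‖ ≤ τ * ‖v‖) (hR0 : ‖a • Aj e + b • Am f‖ ≤ ε * (a + b)) {c' w : EuclideanSpace ℝ (Fin 3)}
    (hc' : InCommonShell P' f c') (hw : w ∈ P) (hR1 : ‖b • Am c' - a • Aj (w - e)‖ ≤ ε * (2 * a + b)) : InCommonShell P e w := by
  obtain ⟨-, hc'1, hc'f⟩ := hc'
  have hεa : ε * (2 * a + b) ≤ 61 / 20000 * a := by nlinarith
  have h0P : (0 : EuclideanSpace ℝ (Fin 3)) ∈ insert (0 : EuclideanSpace ℝ (Fin 3)) P := Finset.mem_insert_self _ _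
  have hwP : w ∈ insert (0 : EuclideanSpace ℝ (Fin 3)) P := Finset.mem_insert_of_mem hw
  have heP : e ∈ insert (0 : EuclideanSpace ℝ (Fin 3)) P := Finset.mem_insert_of_mem he
  -- `‖w − e‖ = 1`
  have hwe : ‖w - e‖ = 1 := by
    have h1 : ‖a • Aj (w - e) - b • Am c'‖ ≤ ε * (2 * a + b) := by rw [norm_sub_rev]; exact hR1
    obtain ⟨hlt, hne⟩ := frame_cmp ha hb hab hba hτ hj hm hc'1 h1 (by linarith)
    rcases norm_sub_eq_one_or_sqrt_two_le_of_twoShell hP hwP heP (fun h => hne (by rw [h, sub_self])) with h | h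
    · exact h
    · exact absurd h (not_le.mpr hlt)
  -- `‖w‖ = 1`
  have hw1 : ‖w‖ = 1 := by
    have h1 : ‖a • Aj w - b • Am (c' - f)‖ ≤ 2 * (ε * (2 * a + b)) := by
      have hsplit : a • Aj w - b • Am (c' - f) = (a • Aj (w - e) - b • Am c') + (a • Aj e + b • Am f) := by
        simp only [map_sub, smul_sub]; abel
      rw [hsplit]
      have := norm_add_le (a • Aj (w - e) - b • Am c') (a • Aj e + b • Am f)
      rw [norm_sub_rev (a • Aj (w - e))] at this
      nlinarith
    have hx' : ‖c' - f‖ = 1 := hc'f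
    obtain ⟨hlt, hne⟩ := frame_cmp ha hb hab hba hτ hj hm hx' h1 (by linarith)
    rcases norm_sub_eq_one_or_sqrt_two_le_of_twoShell hP hwP h0P hne.symm.symm with h | h
    · rw [sub_zero] at h; exact h
    · rw [sub_zero] at h; exact absurd h (not_le.mpr hlt)
  exact ⟨hw, hw1, hwe⟩

/-- **D-B · PAIR SNAP, relative form**: the pair snap from the named bricks EXT (`SnapExtension`) and COMPAT (`SnapCompatibility`) as
hypotheses — all the analysis of the brick, with no dependence on the kernel certificates. [this file; memo NODE-g59-DevSpec §3 L3] -/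
theorem pair_snap_of (hext : SnapExtension) (hcompat : SnapCompatibility) {P P' : Finset (EuclideanSpace ℝ (Fin 3))}
    (hP : P = fccTwoShellPattern ∨ P = hcpTwoShellPattern)
    (hP' : P' = fccTwoShellPattern ∨ P' = hcpTwoShellPattern) {e f : EuclideanSpace ℝ (Fin 3)} (he : e ∈ P) (he1 : ‖e‖ = 1) (hf : f ∈ P')
    (hf1 : ‖f‖ = 1) {Aj Am : EuclideanSpace ℝ (Fin 3) →ₗ[ℝ] EuclideanSpace ℝ (Fin 3)}
    {Qj Qm : EuclideanSpace ℝ (Fin 3) →ₗᵢ[ℝ] EuclideanSpace ℝ (Fin 3)} {a b τ ε : ℝ} (ha : 0 < a) (hb : 0 < b) (hab : b ≤ 21 / 20 * a)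
    (hba : a ≤ 10 / 9 * b) (hτ0 : 0 ≤ τ) (hτ : τ ≤ 1 / 20) (hε0 : 0 ≤ ε) (hε : ε ≤ 1 / 1000) (hj : ∀ v, ‖Aj v - Qj v‖ ≤ τ * ‖v‖)
    (hm : ∀ v, ‖Am v - Qm v‖ ≤ τ * ‖v‖) (hR0 : ‖a • Aj e + b • Am f‖ ≤ ε * (a + b))
    (hR1 : ∀ c', InCommonShell P' f c' → ∃ w ∈ P, ‖b • Am c' - a • Aj (w - e)‖ ≤ ε * (2 * a + b)) :
    ∃ U : EuclideanSpace ℝ (Fin 3) →ₗᵢ[ℝ] EuclideanSpace ℝ (Fin 3),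
      IsSnap P P' e f U.toLinearMap ∧ (∀ v, ‖a • Aj (U v) - b • Am v‖ ≤ 4 * (ε * (2 * a + b)) * ‖v‖) ∧
      ∀ u ∈ insert (0 : EuclideanSpace ℝ (Fin 3)) P, ∀ u' ∈ insert (0 : EuclideanSpace ℝ (Fin 3)) P',
        ‖a • Aj u - a • Aj e - b • Am u'‖ ≤ ε * (2 * a + b) → u = e + U u' := by
  set η₀ := ε * (2 * a + b) with hη₀
  have hη₀0 : 0 ≤ η₀ := by rw [hη₀]; positivity
  have hεa : η₀ ≤ 61 / 20000 * a := by rw [hη₀]; nlinarith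
  have hR0' : ‖a • Aj e + b • Am f‖ ≤ η₀ := hR0.trans (by rw [hη₀]; nlinarith)
  have key : ∀ c' w, InCommonShell P' f c' → w ∈ P → ‖b • Am c' - a • Aj (w - e)‖ ≤ η₀ → InCommonShell P e w :=
    fun c' w hc' hw h => label_inCommonShell hP he ha hb hab hba hτ hε0 hε hj hm hR0 hc' hw h
  -- S0: a good pair of the common shell of `f`, S1: its labels
  obtain ⟨c₁, c₂, hc₁, hc₂, hpair⟩ := exists_goodPair hP' hf hf1
  obtain ⟨w₁, hw₁P, hw₁⟩ := hR1 c₁ hc₁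
  obtain ⟨w₂, hw₂P, hw₂⟩ := hR1 c₂ hc₂
  have hd₁ : InCommonShell P e w₁ := key c₁ w₁ hc₁ hw₁P hw₁
  have hd₂ : InCommonShell P e w₂ := key c₂ w₂ hc₂ hw₂P hw₂
  -- S2: the frame fit `M'` of `b • Am`
  obtain ⟨M', hM'f, hM'c₁, hM'c₂, hM'bd⟩ := frameRealisation_holds f c₁ c₂ hf1 hc₁.2.1 hc₂.2.1 hc₁.2.2 hc₂.2.2 hpair (b • Am)
    (-(a • Aj e)) (a • Aj (w₁ - e)) (a • Aj (w₂ - e)) η₀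
    (by rw [LinearMap.smul_apply, sub_neg_eq_add, add_comm]; exact hR0')
    (by rw [LinearMap.smul_apply]; exact hw₁) (by rw [LinearMap.smul_apply]; exact hw₂)
  -- S3: the exact reading map `M`
  obtain ⟨M, hMf, hMc₁, hMc₂, -⟩ := frameRealisation_holds f c₁ c₂ hf1 hc₁.2.1 hc₂.2.1 hc₁.2.2 hc₂.2.2 hpair 0 (-e) (w₁ - e) (w₂ - e) 1
    (by rw [LinearMap.zero_apply, zero_sub, neg_neg, he1]) (by rw [LinearMap.zero_apply, zero_sub, norm_neg, hd₁.2.2])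
    (by rw [LinearMap.zero_apply, zero_sub, norm_neg, hd₂.2.2])
  -- S4: `a • Aj ∘ M = M'`
  have hcomp : (a • Aj).comp M = M' :=
    linearMap_eq_of_halfFrame hP' hf hf1 hc₁.1 hc₁.2.1 hc₁.2.2 hc₂.1 hc₂.2.1 hc₂.2.2 hpair
      (by simp only [LinearMap.comp_apply, LinearMap.smul_apply, hMf, map_neg, hM'f])
      (by simp only [LinearMap.comp_apply, LinearMap.smul_apply, hMc₁, hM'c₁])
      (by simp only [LinearMap.comp_apply, LinearMap.smul_apply, hMc₂, hM'c₂])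
  have hM : ∀ v, ‖a • Aj (M v) - b • Am v‖ ≤ 4 * η₀ * ‖v‖ := fun v => by
    have h := LinearMap.congr_fun hcomp v
    simp only [LinearMap.comp_apply, LinearMap.smul_apply] at h
    rw [h]; simpa only [LinearMap.smul_apply] using hM'bd v
  -- S5: near-conformality, S6: rigidity
  have hbudget : 5 * (4 * η₀ + 2 * b * τ) ≤ b * (1 - τ) := by nlinarith
  have hconf := nearConformal_transfer ha hb hτ0 (by positivity) hj hm hM hbudget
  have hd₁' : InCommonShell P e (M c₁ + e) := by rw [hMc₁, sub_add_cancel]; exact hd₁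
  have hd₂' : InCommonShell P e (M c₂ + e) := by rw [hMc₂, sub_add_cancel]; exact hd₂
  obtain ⟨U, hUM⟩ := snapRigidity_pair hP he he1 hf1 hc₁ hc₂ hpair M hMf hd₁' hd₂' hconf
  have hUv : ∀ v, U v = M v := fun v => by rw [← hUM]; rfl
  have hUf : U f = -e := by rw [hUv, hMf]
  have hU₁ : InCommonShell P e (U c₁ + e) := by rw [hUv]; exact hd₁'
  have hU₂ : InCommonShell P e (U c₂ + e) := by rw [hUv]; exact hd₂'
  have htrans : ∀ v, ‖a • Aj (U v) - b • Am v‖ ≤ 4 * η₀ * ‖v‖ := fun v => by rw [hUv]; exact hM v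
  -- S7: full snap via EXT
  have hsnap : IsSnap P P' e f U.toLinearMap := by
    refine ⟨by simpa only [LinearIsometry.coe_toLinearMap] using hUf, fun c' hc' => ?_⟩
    simp only [LinearIsometry.coe_toLinearMap]
    obtain ⟨w', hw'P, hw'⟩ := hR1 c' hc'
    have hw'sh : InCommonShell P e w' := key c' w' hc' hw'P hw'
    have h5 : ‖a • Aj (U c' - (w' - e))‖ ≤ 5 * η₀ := by
      have hsplit : a • Aj (U c' - (w' - e)) = (a • Aj (U c') - b • Am c') + (b • Am c' - a • Aj (w' - e)) := by
        simp only [map_sub, smul_sub]; abel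
      rw [hsplit]
      have h1 := htrans c'
      rw [hc'.2.1, mul_one] at h1
      have := norm_add_le (a • Aj (U c') - b • Am c') (b • Am c' - a • Aj (w' - e))
      linarith
    have hlo := frame_lower ha hτ hj (U c' - (w' - e))
    have h6 : a * (19 / 20 * ‖U c' - (w' - e)‖) ≤ a * (61 / 4000) := by nlinarith
    have h7 : 19 / 20 * ‖U c' - (w' - e)‖ ≤ 61 / 4000 := le_of_mul_le_mul_left h6 ha
    have hlt : dist (U c' + e) w' < 1 / 3 := by
      rw [dist_eq_norm, show U c' + e - w' = U c' - (w' - e) by abel]; linarith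
    rw [hext P P' hP hP' e he he1 f hf hf1 c₁ c₂ hc₁ hc₂ hpair U hUf hU₁ hU₂ c' hc' w' hw'sh hlt]
    exact hw'sh
  refine ⟨U, hsnap, htrans, fun u hu u' hu' hfit => ?_⟩
  -- S9: rounding via COMPAT
  have hu'n : ‖u'‖ ≤ 3 / 2 := by
    rcases Finset.mem_insert.1 hu' with rfl | hu'
    · rw [norm_zero]; norm_num
    · exact (norm_le_sqrt_two_of_mem_twoShellPattern hP' hu').trans sqrt_two_le_three_halves
  have h7 : ‖a • Aj ((u - e) - U u')‖ ≤ 7 * η₀ := by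
    have hsplit : a • Aj ((u - e) - U u') = (a • Aj u - a • Aj e - b • Am u') + (b • Am u' - a • Aj (U u')) := by
      simp only [map_sub, smul_sub]; abel
    rw [hsplit]
    have h1 := htrans u'
    rw [norm_sub_rev] at h1
    have h2 : 4 * η₀ * ‖u'‖ ≤ 4 * η₀ * (3 / 2) := mul_le_mul_of_nonneg_left hu'n (by positivity)
    have := norm_add_le (a • Aj u - a • Aj e - b • Am u') (b • Am u' - a • Aj (U u'))
    linarith
  have hlo := frame_lower ha hτ hj ((u - e) - U u')
  have h8 : a * (19 / 20 * ‖(u - e) - U u'‖) ≤ a * (427 / 20000) := by nlinarith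
  have h9 : 19 / 20 * ‖(u - e) - U u'‖ ≤ 427 / 20000 := le_of_mul_le_mul_left h8 ha
  have hlt : dist u (e + U u') < 1 := by
    rw [dist_eq_norm, show u - (e + U u') = (u - e) - U u' by abel]; linarith
  exact hcompat P P' hP hP' e he he1 f hf hf1 U hsnap u hu u' hu' hlt

/-- **D-B · PAIR SNAP.**  See the module docstring (`pair_snap_of` instantiated with `snapExtension_holds`, `snapCompatibility_holds`).
[this file; memo NODE-g59-DevSpec §3 L3] -/
theorem pair_snap {P P' : Finset (EuclideanSpace ℝ (Fin 3))} (hP : P = fccTwoShellPattern ∨ P = hcpTwoShellPattern)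
    (hP' : P' = fccTwoShellPattern ∨ P' = hcpTwoShellPattern) {e f : EuclideanSpace ℝ (Fin 3)} (he : e ∈ P) (he1 : ‖e‖ = 1) (hf : f ∈ P')
    (hf1 : ‖f‖ = 1) {Aj Am : EuclideanSpace ℝ (Fin 3) →ₗ[ℝ] EuclideanSpace ℝ (Fin 3)}
    {Qj Qm : EuclideanSpace ℝ (Fin 3) →ₗᵢ[ℝ] EuclideanSpace ℝ (Fin 3)} {a b τ ε : ℝ} (ha : 0 < a) (hb : 0 < b) (hab : b ≤ 21 / 20 * a)
    (hba : a ≤ 10 / 9 * b) (hτ0 : 0 ≤ τ) (hτ : τ ≤ 1 / 20) (hε0 : 0 ≤ ε) (hε : ε ≤ 1 / 1000) (hj : ∀ v, ‖Aj v - Qj v‖ ≤ τ * ‖v‖)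
    (hm : ∀ v, ‖Am v - Qm v‖ ≤ τ * ‖v‖) (hR0 : ‖a • Aj e + b • Am f‖ ≤ ε * (a + b))
    (hR1 : ∀ c', InCommonShell P' f c' → ∃ w ∈ P, ‖b • Am c' - a • Aj (w - e)‖ ≤ ε * (2 * a + b)) :
    ∃ U : EuclideanSpace ℝ (Fin 3) →ₗᵢ[ℝ] EuclideanSpace ℝ (Fin 3),
      IsSnap P P' e f U.toLinearMap ∧ (∀ v, ‖a • Aj (U v) - b • Am v‖ ≤ 4 * (ε * (2 * a + b)) * ‖v‖) ∧
      ∀ u ∈ insert (0 : EuclideanSpace ℝ (Fin 3)) P, ∀ u' ∈ insert (0 : EuclideanSpace ℝ (Fin 3)) P',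
        ‖a • Aj u - a • Aj e - b • Am u'‖ ≤ ε * (2 * a + b) → u = e + U u' :=
  pair_snap_of snapExtension_holds snapCompatibility_holds hP hP' he he1 hf hf1 ha hb hab hba hτ0 hτ hε0 hε hj hm hR0 hR1

/-! ## §3  Instantiation from the fits of `AffFramed`

In DEV the hypotheses (R0), (R1), the rounding input and the labelling window are read off the `ε·nn`-fits of the two sites; the first four lemmas
below are that bookkeeping, in fit space (`yp, yn, yk` the physical positions); `fit_scale` is the scale comparability L1. -/

/-- (R0) from the two mutual fits. [this file] -/
theorem fit_R0 {yp yn e f : EuclideanSpace ℝ (Fin 3)} {Aj Am : EuclideanSpace ℝ (Fin 3) →ₗ[ℝ] EuclideanSpace ℝ (Fin 3)} {a b ε : ℝ}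
    (hpe : dist yn (yp + a • Aj e) ≤ ε * a) (hnf : dist yp (yn + b • Am f) ≤ ε * b) : ‖a • Aj e + b • Am f‖ ≤ ε * (a + b) := by
  have hsplit : a • Aj e + b • Am f = (yp + a • Aj e - yn) + (yn + b • Am f - yp) := by abel
  rw [hsplit]
  rw [dist_comm, dist_eq_norm] at hpe hnf
  have := norm_add_le (yp + a • Aj e - yn) (yn + b • Am f - yp)
  linarith

/-- (R1) from the three fits of a common neighbour `yk`. [this file] -/
theorem fit_R1 {yp yn yk e c' w : EuclideanSpace ℝ (Fin 3)} {Aj Am : EuclideanSpace ℝ (Fin 3) →ₗ[ℝ] EuclideanSpace ℝ (Fin 3)} {a b ε : ℝ}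
    (hnk : dist yk (yn + b • Am c') ≤ ε * b) (hpk : dist yk (yp + a • Aj w) ≤ ε * a) (hpe : dist yn (yp + a • Aj e) ≤ ε * a) :
    ‖b • Am c' - a • Aj (w - e)‖ ≤ ε * (2 * a + b) := by
  have hsplit : b • Am c' - a • Aj (w - e) = (yn + b • Am c' - yk) + (yk - (yp + a • Aj w)) + (yp + a • Aj e - yn) := by
    simp only [map_sub, smul_sub]; abel
  rw [hsplit]
  rw [dist_comm, dist_eq_norm] at hnk hpe
  rw [dist_eq_norm] at hpk
  have h1 := norm_add_le (yn + b • Am c' - yk) (yk - (yp + a • Aj w))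
  have h2 := norm_add_le ((yn + b • Am c' - yk) + (yk - (yp + a • Aj w))) (yp + a • Aj e - yn)
  linarith

/-- ROUNDING input from the two readings of one site `yk`. [this file] -/
theorem fit_round {yp yn yk e u u' : EuclideanSpace ℝ (Fin 3)} {Aj Am : EuclideanSpace ℝ (Fin 3) →ₗ[ℝ] EuclideanSpace ℝ (Fin 3)} {a b ε : ℝ}
    (hpk : dist yk (yp + a • Aj u) ≤ ε * a) (hnk : dist yk (yn + b • Am u') ≤ ε * b) (hpe : dist yn (yp + a • Aj e) ≤ ε * a) :
    ‖a • Aj u - a • Aj e - b • Am u'‖ ≤ ε * (2 * a + b) := by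
  have hsplit : a • Aj u - a • Aj e - b • Am u' = (yp + a • Aj u - yk) + (yk - (yn + b • Am u')) + (yn - (yp + a • Aj e)) := by abel
  rw [hsplit]
  rw [dist_comm, dist_eq_norm] at hpk
  rw [dist_eq_norm] at hnk hpe
  have h1 := norm_add_le (yp + a • Aj u - yk) (yk - (yn + b • Am u'))
  have h2 := norm_add_le ((yp + a • Aj u - yk) + (yk - (yn + b • Am u'))) (yn - (yp + a • Aj e))
  linarith

/-- LABELLING WINDOW: a common neighbour of `f` at `n` lies within `(3/2)·a` of `yp`, hence inside the exhaustiveness window of `AffFramed` at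
`p`. [this file] -/
theorem fit_window {yp yn yk e f c' : EuclideanSpace ℝ (Fin 3)} {Aj Am : EuclideanSpace ℝ (Fin 3) →ₗ[ℝ] EuclideanSpace ℝ (Fin 3)}
    {Qm : EuclideanSpace ℝ (Fin 3) →ₗᵢ[ℝ] EuclideanSpace ℝ (Fin 3)} {a b τ ε : ℝ} (ha : 0 < a) (hb : 0 < b) (hab : b ≤ 21 / 20 * a)
    (hτ : τ ≤ 1 / 20) (hε : ε ≤ 1 / 1000) (hm : ∀ v, ‖Am v - Qm v‖ ≤ τ * ‖v‖) (hc'f : ‖c' - f‖ = 1)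
    (hR0 : ‖a • Aj e + b • Am f‖ ≤ ε * (a + b)) (hnk : dist yk (yn + b • Am c') ≤ ε * b) (hpe : dist yn (yp + a • Aj e) ≤ ε * a) :
    dist yk yp ≤ 3 / 2 * a := by
  have hsplit : yk - yp = (yk - (yn + b • Am c')) + (yn - (yp + a • Aj e)) + (a • Aj e + b • Am f) + b • Am (c' - f) := by
    simp only [map_sub, smul_sub]; abel
  rw [dist_eq_norm, hsplit]
  rw [dist_eq_norm] at hnk hpe
  have hup := frame_upper hb hτ hm (c' - f)
  rw [hc'f, mul_one] at hup
  have h1 := norm_add_le (yk - (yn + b • Am c')) (yn - (yp + a • Aj e))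
  have h2 := norm_add_le ((yk - (yn + b • Am c')) + (yn - (yp + a • Aj e))) (a • Aj e + b • Am f)
  have h3 := norm_add_le ((yk - (yn + b • Am c')) + (yn - (yp + a • Aj e)) + (a • Aj e + b • Am f)) (b • Am (c' - f))
  nlinarith

/-- SCALE COMPARABILITY (L1): the nearest-neighbour distance of a labelled neighbour `n` of `p` is at most `(1 + τ + ε)·a`, `a` the reading
scale of `p` — with `τ + ε ≤ 1/20` this is the hypothesis `b ≤ 21a/20` of `pair_snap` (and symmetrically `a ≤ 21b/20 ≤ 10b/9`). [this file] -/
theorem fit_scale {N : ℕ} {y : Fin N → EuclideanSpace ℝ (Fin 3)} {p n : Fin N} (hpn : p ≠ n) {e : EuclideanSpace ℝ (Fin 3)}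
    {A : EuclideanSpace ℝ (Fin 3) →ₗ[ℝ] EuclideanSpace ℝ (Fin 3)} {Q : EuclideanSpace ℝ (Fin 3) →ₗᵢ[ℝ] EuclideanSpace ℝ (Fin 3)} {a τ ε : ℝ}
    (ha : 0 ≤ a) (hA : ∀ v, ‖A v - Q v‖ ≤ τ * ‖v‖) (he1 : ‖e‖ = 1) (hfit : dist (y n) (y p + a • A e) ≤ ε * a) :
    nearestDist y n ≤ (1 + τ + ε) * a := by
  have h1 : nearestDist y n ≤ dist (y n) (y p) := nearestDist_le_dist y hpn
  have h2 : dist (y n) (y p) ≤ dist (y n) (y p + a • A e) + dist (y p + a • A e) (y p) := dist_triangle _ _ _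
  have h3 : dist (y p + a • A e) (y p) = a * ‖A e‖ := by
    rw [dist_eq_norm, add_sub_cancel_left, norm_smul, Real.norm_eq_abs, abs_of_nonneg ha]
  have h4 : ‖A e‖ ≤ 1 + τ := by
    have := norm_le_insert' (A e) (Q e); rw [LinearIsometry.norm_map, he1] at this
    have h := hA e; rw [he1, mul_one] at h; linarith
  have h5 : a * ‖A e‖ ≤ a * (1 + τ) := mul_le_mul_of_nonneg_left h4 ha
  linarith

end Summit.AtomisticToContinuum.Crystallization.Theorems.OverbindingBudgetAffineFarSmoothSplit
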